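import Summits.NavierStokesRegularity.FluidComputer.ForcedContinuationEnstrophy
import HarnessLib

/-!
# Leray's `H¹` blow-up RATE for a designed forced blow-up, modulo Tao's forced local theory ALONE:
# `(√(E + ∫|∇u(t)|²) + B + 1)⁴ ≥ c ν³ / (T − t)`

Cell `ns-blowup`, seat `ns-blowup-ecbridge-2` (g4; the E–C endpoint theory seat). LABEL: E–C typing
(KERNEL modulo ONE named fact, F2 = `tao2011_smooth_local_existence_forced`). WHAT THIS IS NOT: not
Navier–Stokes evidence — a necessary condition on the TYPE `DesignedBlowup`; nothing constructed.
Companion memo: `run/shared/lean/pub/ns-blowup/ecbridge2/ECBRIDGE-2-MEMO-3.md` §1 (G), §2 (row R5′).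

## Content

Tao's forced local theorem (F2) has a QUANTITATIVE lifespan: from an `H^∞` datum of `H¹`-radius `A`
under a force of slab-`H¹`-size `B`, a classical solution lives for time `h = min(1, c ν³/(A+B+1)⁴)`
(`(A + B h)⁴ h ≤ c ν³`). Restarting at ANY time `t₀ < τ` of a classical solution on `[0, τ)` and gluing
(`exists_forced_extension_of_piece`, this seat's single-restart gluing with the identification
interval `[t₀, (t₀+τ)/2]` — ecbridge-1 g5's W14-free `piece_eq_shift` and `glue_Icc`) gives an
extension past `τ` as soon as `h(A(t₀)) > τ − t₀`. Contrapositive, for a solution WITHOUT extension: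

* **`ForcedContinuation.lifespan_le_of_no_extension`** — GIVEN F2: for a classical forced solution on
  `[0, τ)` (`ν > 0`, Clay force, uniform energy `E₀`, Tao's spatial class on closed sub-slabs) with
  NO classical extension past `τ`, there are `c > 0` (Tao's constant) and `B ≥ 0` (the force's slab
  `H¹` size) with `min(1, c ν³/(√(E₀ + ∫|∇u(t₀)|²) + B + 1)⁴) ≤ τ − t₀` for EVERY `t₀ ∈ [0, τ)`;
* **`DesignedBlowup.enstrophy_rate_of_F2`** — for every designed forced blow-up (`ν > 0`), GIVEN F2
  only: `min(1, c ν³/(√(E + ∫|∇u(t)|²) + B + 1)⁴) ≤ T − t` on `[0, T)` — i.e. for `T − t < 1`,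
  `(√(E + ∫|∇u(t)|²) + B + 1)⁴ ≥ c ν³/(T − t)`: the `H¹` norm blows up at least like `(T − t)^{−1/4}`
  (Leray 1934, (3.16), the `H¹` form of Leray's rate; LR16 Thm. 11.4). FACT-FREE except for F2.

References: J. Leray, Acta Math. 63 (1934), §20 (3.16) [cite: Leray1934, (3.16)]; T. Tao, Anal. PDE 6
(2013) = arXiv:1108.1165, Thm. 5.4 (ii)+(iv) [cite: Tao2011, Thm. 5.4]; P. G. Lemarié-Rieusset (2016),
Thm. 11.4 [cite: LemarieRieusset2016, Thm. 11.4]; H. Sohr (2001), Thm. V.1.5.1 [cite: Sohr2001, Thm. V.1.5.1].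
-/

noncomputable section

open MeasureTheory Set Function Filter Topology
open scoped ENNReal NNReal ContDiff

namespace Summit.NavierStokesRegularity.FluidComputer.PalasekTowerClayBridge

open Literature.Analysis.FluidPDE

namespace ForcedContinuation

section Rate

variable {ν τ : ℝ} {f u : ℝ → EuclideanSpace ℝ (Fin 3) → EuclideanSpace ℝ (Fin 3)}
  {p : ℝ → EuclideanSpace ℝ (Fin 3) → ℝ}

/-- **Gluing a restarted piece that reaches past `τ`** (the single-restart gluing of
`exists_forced_extension_of_enstrophy_bounded_Ico`, with the piece as INPUT and the identification
interval `[t_N, (t_N + τ)/2]`): a classical forced solution on `[0, τ)` with uniform energy and Tao's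
spatial class on closed sub-slabs, plus a classical finite-energy piece `(w, q)` on `[0, h]` under the
shifted force from the datum `u(t_N)`, `0 ≤ t_N < τ < t_N + h`, give a classical finite-energy
extension to the CLOSED slab `[0, t_N + h]` agreeing with `u` on `[0, τ)`.
[cite: Tao2011, Thm. 5.4 (ii)+(iv)] [cite: Sohr2001, Thm. V.1.5.1] -/
theorem exists_forced_extension_of_piece (hν : 0 < ν) (hs : IsSmoothOnHalfSpace f)
    (hd : HasRapidSpaceTimeDecay f) (hu : IsClassicalNSSolutionOn (Ico 0 τ) ν f u p)
    (hE : ∃ C : ℝ≥0∞, C < ⊤ ∧ ∀ t ∈ Ico 0 τ, ∫⁻ x, ‖u t x‖ₑ ^ 2 ≤ C)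
    (hTao : ∀ τ₁ ∈ Ioo 0 τ, HasBoundedSobolevNormsOn (Icc 0 τ₁) u)
    {h tN : ℝ} (htN0 : 0 ≤ tN) (htNτ : tN < τ) (hNspec : τ < tN + h)
    {w : ℝ → EuclideanSpace ℝ (Fin 3) → EuclideanSpace ℝ (Fin 3)}
    {q : ℝ → EuclideanSpace ℝ (Fin 3) → ℝ}
    (hw : IsClassicalNSSolutionOn (Icc 0 h) ν (fun s => f (s + tN)) w q) (hw0 : w 0 = u tN)
    (hEw : ∃ C : ℝ≥0∞, C < ⊤ ∧ ∀ t ∈ Icc 0 h, ∫⁻ x, ‖w t x‖ₑ ^ 2 ≤ C) :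
    ∃ T' : ℝ, τ < T' ∧
      ∃ (U : ℝ → EuclideanSpace ℝ (Fin 3) → EuclideanSpace ℝ (Fin 3))
        (P : ℝ → EuclideanSpace ℝ (Fin 3) → ℝ),
        IsClassicalNSSolutionOn (Icc 0 T') ν f U P ∧
        (∀ t ∈ Ico 0 τ, U t = u t) ∧
        (∃ C : ℝ≥0∞, C < ⊤ ∧ ∀ t ∈ Icc 0 T', ∫⁻ x, ‖U t x‖ₑ ^ 2 ≤ C) := by
  obtain ⟨E₀, hE₀, hEb⟩ := hE
  have hhpos : 0 < h := by linarith
  have huc : ∀ τ₁, 0 < τ₁ → τ₁ < τ → IsClassicalNSSolutionOn (Icc 0 τ₁) ν f u p := fun τ₁ h₁ h₂ =>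
    hu.mono (fun t ht => ⟨ht.1, lt_of_le_of_lt ht.2 h₂⟩) (uniqueDiffOn_Icc h₁)
  have hEc : ∀ τ₁, τ₁ < τ → ∃ C : ℝ≥0∞, C < ⊤ ∧ ∀ t ∈ Icc 0 τ₁, ∫⁻ x, ‖u t x‖ₑ ^ 2 ≤ C :=
    fun τ₁ h₂ => ⟨E₀, hE₀, fun t ht => hEb t ⟨ht.1, lt_of_le_of_lt ht.2 h₂⟩⟩
  have hMc : ∀ τ₁, 0 < τ₁ → τ₁ < τ → ∃ M : ℝ, ∀ t ∈ Icc 0 τ₁, ∀ x, ‖u t x‖ ≤ M :=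
    fun τ₁ h₁ h₂ => exists_bound_Icc_of_taoClass hu hTao h₁ h₂
  -- the identification half-width `δ = (τ − tN)/2`
  set δ : ℝ := (τ - tN) / 2 with hδ
  have hδ0 : 0 < δ := by rw [hδ]; linarith
  have hδτ : tN + δ < τ := by rw [hδ]; linarith
  have hδh : δ ≤ h := by rw [hδ]; linarith
  obtain ⟨Mδ, hMδ⟩ := hMc _ (by linarith) hδτ
  have heq : ∀ s ∈ Icc 0 δ, w s = u (s + tN) :=
    piece_eq_shift hν hs hd (huc _ (by linarith) hδτ) (hEc _ hδτ) hMδ htN0 hδ0 le_rfl hδh hw hEw hw0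
  obtain ⟨q', hw', hq'⟩ := IsClassicalNSSolutionOn.exists_pressure_eq_on_Icc
    (shift_classical (huc _ (by linarith) hδτ) htN0 hδ0 le_rfl) hw hδ0 hδh heq
  -- shift the piece back to `[tN, tN + h]`
  set W : ℝ → EuclideanSpace ℝ (Fin 3) → EuclideanSpace ℝ (Fin 3) := fun t => w (t + -tN) with hW
  set Q : ℝ → EuclideanSpace ℝ (Fin 3) → ℝ := fun t => q' (t + -tN) with hQ
  have hWsol : IsClassicalNSSolutionOn (Icc tN (tN + h)) ν f W Q := by
    have h1 := (hw'.comp_add_right (-tN)).mono (S' := Icc tN (tN + h))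
      (fun t ht => ⟨by linarith [ht.1], by linarith [ht.2]⟩) (uniqueDiffOn_Icc (by linarith))
    refine ⟨h1.smooth_velocity, h1.smooth_pressure, fun t ht x => ?_, h1.divFree⟩
    have h2 := h1.momentum t ht x
    simp only [neg_add_cancel_right] at h2
    exact h2
  have hagree : ∀ t ∈ Icc tN (tN + δ), u t = W t ∧ p t = Q t := by
    intro t ht
    have hmem : t + -tN ∈ Icc 0 δ := ⟨by linarith [ht.1], by linarith [ht.2]⟩
    refine ⟨?_, ?_⟩
    · show u t = w (t + -tN)
      rw [heq _ hmem, neg_add_cancel_right]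
    · show p t = q' (t + -tN)
      rw [hq' _ hmem, neg_add_cancel_right]
  have hagreeU : ∀ t, tN < t → t < τ → W t = u t := by
    intro t ht1 ht2
    have hτ' : 0 < t + -tN := by linarith only [ht1]
    have hle : tN + (t + -tN) ≤ t := le_of_eq (by ring)
    have hh' : t + -tN ≤ h := by linarith only [ht2, hNspec]
    have ht0 : 0 < t := lt_of_le_of_lt htN0 ht1
    obtain ⟨Mt, hMt⟩ := hMc t ht0 ht2
    have key : ∀ s ∈ Icc 0 (t + -tN), w s = u (s + tN) :=
      piece_eq_shift (τ := t) (t₀ := tN) (τ' := t + -tN) (T := h) hν hs hd (huc t ht0 ht2)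
        (hEc t ht2) hMt htN0 hτ' hle hh' hw hEw hw0
    have key' := key (t + -tN) ⟨hτ'.le, le_rfl⟩
    show w (t + -tN) = u t
    rw [key', neg_add_cancel_right]
  -- glue along `(tN, tN + δ)`
  set m : ℝ := tN + δ / 2 with hm
  have hglue := IsClassicalNSSolutionOn.glue_Icc (huc _ (by linarith) hδτ) hWsol htN0
    (by rw [hm]; linarith : tN < m) (by rw [hm]; linarith : m < tN + δ)
    (by linarith : tN + δ ≤ tN + h) (fun t ht => hagree t ⟨ht.1.le, ht.2.le⟩)
  obtain ⟨Cw, hCwt, hCw⟩ := hEw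
  refine ⟨tN + h, hNspec, _, _, hglue, fun t ht => ?_, ⟨max E₀ Cw, max_lt hE₀ hCwt, fun t ht => ?_⟩⟩
  · by_cases htm : t ≤ m
    · exact if_pos htm
    · simp only [if_neg htm]
      exact hagreeU t (by rw [hm] at htm; linarith) ht.2
  · by_cases htm : t ≤ m
    · simp only [if_pos htm]
      exact (hEb t ⟨ht.1, by rw [hm] at htm; linarith⟩).trans (le_max_left _ _)
    · simp only [if_neg htm]
      show ∫⁻ x, ‖w (t + -tN) x‖ₑ ^ 2 ≤ max E₀ Cw
      exact (hCw (t + -tN) ⟨by rw [hm] at htm; linarith, by linarith [ht.2]⟩).trans (le_max_right _ _)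

/-- **Tao's lifespan bound at every time of a solution without extension**, GIVEN F2. Let `(u, p)` be
classical on `[0, τ) × ℝ³` (`ν > 0`, Clay force) with uniform energy `≤ E₀ < ⊤` and Tao's spatial
class on closed sub-slabs, and NO classical extension past `τ`. Then there are `c > 0` (the absolute
constant of Tao's Thm. 5.4 (ii) WITH force) and `B ≥ 0` (the force's slab `H¹` size) such that for EVERY
`t₀ ∈ [0, τ)`: `min(1, c ν³ / (√((E₀ + ∫|∇u(t₀)|²).toReal) + B + 1)⁴) ≤ τ − t₀` — otherwise one restart of F2 at `t₀`
would reach past `τ` (`exists_forced_extension_of_piece`). [cite: Tao2011, Thm. 5.4 (ii)+(iv)]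
[cite: Leray1934, (3.16)] -/
theorem lifespan_le_of_no_extension (hF : tao2011_smooth_local_existence_forced) (hν : 0 < ν)
    (hs : IsSmoothOnHalfSpace f) (hd : HasRapidSpaceTimeDecay f)
    (hu : IsClassicalNSSolutionOn (Ico 0 τ) ν f u p)
    {E₀ : ℝ≥0∞} (hE₀ : E₀ < ⊤) (hEb : ∀ t ∈ Ico 0 τ, ∫⁻ x, ‖u t x‖ₑ ^ 2 ≤ E₀)
    (hTao : ∀ τ₁ ∈ Ioo 0 τ, HasBoundedSobolevNormsOn (Icc 0 τ₁) u)
    (hmax : ¬ HasSmoothExtensionPast ν f u τ) :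
    ∃ c : ℝ, 0 < c ∧ ∃ B : ℝ, 0 ≤ B ∧ ∀ t₀ ∈ Ico 0 τ,
      min 1 (c * ν ^ 3 /
        (Real.sqrt (E₀ + ∫⁻ x, ENNReal.ofReal (frobeniusNormSq (fderiv ℝ (u t₀) x))).toReal + B + 1) ^ 4)
        ≤ τ - t₀ := by
  obtain ⟨c, hc, hloc⟩ := hF
  obtain ⟨C₀, C₁, B, hB0, hC₀, hC₁, hBf⟩ := exists_force_slice_bounds hs hd
  refine ⟨c, hc, B, hB0, fun t₀ ht₀ => ?_⟩
  by_contra hlt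
  rw [not_le] at hlt
  -- the slice `u t₀`: `H^∞`, with energy `≤ E₀` and finite enstrophy `K`
  have hmid : t₀ < (t₀ + τ) / 2 ∧ (t₀ + τ) / 2 < τ := ⟨by linarith [ht₀.2], by linarith [ht₀.2]⟩
  have hHinf : ∀ m : ℕ, ∫⁻ x, ‖iteratedFDeriv ℝ m (u t₀) x‖ₑ ^ 2 < ⊤ := fun m => by
    obtain ⟨C, hC⟩ := hTao _ ⟨ht₀.1.trans_lt hmid.1, hmid.2⟩ m
    exact (hC t₀ ⟨ht₀.1, hmid.1.le⟩).trans_lt ENNReal.coe_lt_top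
  set K : ℝ≥0∞ := ∫⁻ x, ENNReal.ofReal (frobeniusNormSq (fderiv ℝ (u t₀) x)) with hK
  have hKt : K < ⊤ :=
    (lintegral_frobeniusNormSq_le_three_mul_iteratedFDeriv_one (u t₀)).trans_lt
      (ENNReal.mul_lt_top (by simp) (hHinf 1))
  -- the `H¹` radius `A` and the lifespan `h`
  set A : ℝ := Real.sqrt (E₀ + K).toReal with hA
  have hA0 : 0 ≤ A := Real.sqrt_nonneg _
  have hA2 : ENNReal.ofReal (A ^ 2) = E₀ + K := by
    rw [hA, Real.sq_sqrt ENNReal.toReal_nonneg, ENNReal.ofReal_toReal]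
    exact (ENNReal.add_lt_top.2 ⟨hE₀, hKt⟩).ne
  set h : ℝ := min 1 (c * ν ^ 3 / (A + B + 1) ^ 4) with hh
  have hh1 : h ≤ 1 := min_le_left _ _
  have hhc : h ≤ c * ν ^ 3 / (A + B + 1) ^ 4 := min_le_right _ _
  have hhpos : 0 < h := lt_min one_pos (by positivity)
  have hhgt : τ - t₀ < h := hlt
  have hsmall : (A + B * h) ^ 4 * h ≤ c * ν ^ 3 := by
    have h1 : A + B * h ≤ A + B + 1 := by nlinarith
    have h2 : 0 ≤ A + B * h := by positivity
    calc (A + B * h) ^ 4 * h ≤ (A + B + 1) ^ 4 * h :=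
          mul_le_mul_of_nonneg_right (pow_le_pow_left₀ h2 h1 4) hhpos.le
      _ ≤ (A + B + 1) ^ 4 * (c * ν ^ 3 / (A + B + 1) ^ 4) :=
          mul_le_mul_of_nonneg_left hhc (by positivity)
      _ = c * ν ^ 3 := by field_simp
  have hdat : (∫⁻ x, ‖u t₀ x‖ₑ ^ 2) +
      (∫⁻ x, ENNReal.ofReal (frobeniusNormSq (fderiv ℝ (u t₀) x))) ≤ ENNReal.ofReal (A ^ 2) := by
    rw [hA2]; exact add_le_add (hEb t₀ ht₀) le_rfl
  have hfB : ∀ t ∈ Icc 0 h, (∫⁻ x, ‖(fun s => f (s + t₀)) t x‖ₑ ^ 2) +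
      (∫⁻ x, ENNReal.ofReal (frobeniusNormSq (fderiv ℝ ((fun s => f (s + t₀)) t) x))) ≤
        ENNReal.ofReal (B ^ 2) := fun t ht => hBf (t + t₀) (by linarith [ht.1, ht₀.1])
  obtain ⟨w, q, hw, hw0, hwS, -, -, -⟩ := hloc hν hhpos (hu.contDiff_velocity ht₀)
    (hu.divFree t₀ ht₀) hHinf (hs.isSmoothSpaceTimeOn_Icc_timeShift ht₀.1 h)
    (hd.hasUniformRapidDecayOn_Icc_timeShift hs ht₀.1 hhpos) hA0 hB0 hdat hfB hsmall
  have hEw : ∃ C : ℝ≥0∞, C < ⊤ ∧ ∀ t ∈ Icc 0 h, ∫⁻ x, ‖w t x‖ₑ ^ 2 ≤ C := by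
    obtain ⟨C, hC⟩ := hwS 0
    refine ⟨C, ENNReal.coe_lt_top, fun t ht => ?_⟩
    refine le_trans (le_of_eq (lintegral_congr fun x => ?_)) (hC t ht)
    rw [← ofReal_norm, ← ofReal_norm, norm_iteratedFDeriv_zero]
  obtain ⟨T', hT', U, P, hUP, hagree, -⟩ := exists_forced_extension_of_piece hν hs hd hu
    ⟨E₀, hE₀, hEb⟩ hTao ht₀.1 ht₀.2 (by linarith) hw hw0 hEw
  exact hmax ⟨T', hT', U, P, hUP.mono Ico_subset_Icc_self (uniqueDiffOn_Ico 0 T'), hagree⟩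

end Rate

end ForcedContinuation

end Summit.NavierStokesRegularity.FluidComputer.PalasekTowerClayBridge

/-! ## Leray's `H¹` rate for every designed forced blow-up, modulo F2 alone -/

namespace Summit.NavierStokesRegularity.FluidComputer.DesignedBlowup

open Set MeasureTheory
open scoped ENNReal NNReal
open Literature.Analysis.FluidPDE
open Summit.NavierStokesRegularity.FluidComputer.PalasekTowerClayBridge

variable {ν : ℝ} (D : DesignedBlowup ν)

/-- **LERAY'S `H¹` BLOW-UP RATE FOR A DESIGNED FORCED BLOW-UP, GIVEN F2 ONLY** (`ν > 0`): there are
`c > 0`, `B ≥ 0` and a finite `E` (the uniform energy bound, fact-free) such that for every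
`t ∈ [0, T)`: `min(1, c ν³ / (√((E + ∫|∇u(t)|²).toReal) + B + 1)⁴) ≤ T − t`. For `T − t < 1` this reads
`(√(E + ∫|∇u(t)|²) + B + 1)⁴ ≥ c ν³ / (T − t)`: the enstrophy blows up at least like `(T − t)^{−1/2}`
up to the additive constants — Leray's rate in `H¹` form, as a theorem about the type modulo Tao's
forced local theory (no LR16 fact, no pressure or `∂ₜu` hypothesis). [cite: Leray1934, (3.16)]
[cite: Tao2011, Thm. 5.4 (ii)+(iv)] [cite: LemarieRieusset2016, Thm. 11.4] -/
theorem enstrophy_rate_of_F2 (hF : tao2011_smooth_local_existence_forced) (hν : 0 < ν) :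
    ∃ c : ℝ, 0 < c ∧ ∃ B : ℝ, 0 ≤ B ∧ ∃ E : ℝ≥0∞, E < ⊤ ∧ ∀ t ∈ Ico 0 D.T,
      min 1 (c * ν ^ 3 /
        (Real.sqrt (E + ∫⁻ x, ENNReal.ofReal (frobeniusNormSq (fderiv ℝ (D.u t) x))).toReal + B + 1) ^ 4)
        ≤ D.T - t := by
  obtain ⟨E, hEt, hE⟩ := D.energy_le hν
  obtain ⟨c, hc, B, hB, hrate⟩ := ForcedContinuation.lifespan_le_of_no_extension hF hν
    D.force_smooth D.force_decay D.classical hEt hE (D.hasBoundedSobolevNormsOn_subslabs hν)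
    D.no_extension
  exact ⟨c, hc, B, hB, E, hEt, hrate⟩

end Summit.NavierStokesRegularity.FluidComputer.DesignedBlowup

end
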